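import Literature.Probability.RandomPlanarGeometry.LoewnerThrClock
import Literature.Probability.RandomPlanarGeometry.LoewnerThrPieces
import Literature.Probability.RandomPlanarGeometry.LoewnerImageFlow
import Literature.Probability.RandomPlanarGeometry.SLEImageBM
import HarnessLib

/-!
# The through-swallow image Brownian motion of SLE₆ under a `*`-hull (DDS packaging)

Topic `Probability/RandomPlanarGeometry`; one theorem (crux `stmt-CriticalPhenomena-0698`, stub
`stub_isLocal`, through-swallow image chain of the locality of SLE₆; Lawler–Schramm–Werner (2001)
Thm. 2.2: "`W̃_{τ(s)}/√6` is a standard Brownian motion", here THROUGH the swallow instants). The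
Dambis–Dubins–Schwarz packaging of `SLEImageBM.exists_sle_image_brownian` transposed to the
through-swallow image driving value `thrImageDriver` stopped at a bounded horizon `H` with the
through-swallow clock `thrClock` (`LoewnerRemainingHull.lean`, clock API `LoewnerThrClock.lean`):
given the martingale clock structure of the stopped process (the stochastic gluing, stub
`stub_thrGluing`) together with its adaptedness / continuity by-products and the integrability of the
clock rate up to the horizon, there is a real Brownian motion `Bc` on the product of two Wiener spaces
with `√6 · Bc s = thrImageDriverC W A T₀ s` for `s ≤ σ(T₀)`, `T₀ = H > 0` (time change by the clock,
`HasMartingaleClock.timeChange`; concatenation with an independent Brownian motion,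
`isBrownianReal_concat`; read back through `tcProc_clock`).
-/

noncomputable section

open Set Filter Function MeasureTheory ProbabilityTheory
open _root_.Topology
open Literature.Probability.Process
open scoped NNReal

namespace Literature.Probability.RandomPlanarGeometry

open Loewner PathOps

variable {A : Set ℂ}

/-- **The through-swallow image Brownian motion** (DDS packaging). With `W = drvK 6 (brownianCPath ω)`,
`Y t ω = (√6)⁻¹ · (thrImageDriver W A · stopped at H) t` and `c t ω = thrClock W A (t ∧ H)`: if `(Y, c)`
is a martingale clock pair for the Brownian filtration (bound `C`), `Y` is strongly adapted with
continuous paths, `c` is adapted, `H` is a stopping time bounded by the constant `T`, and the clock rate is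
integrable up to the horizon, then for some real Brownian motion `Bc` on the product of two Wiener
spaces (measurable marginals, continuous paths), `√6 · Bc s z = thrImageDriverC W A T₀ s` whenever
`H z.1 = T₀ > 0` and `s ≤ thrClock W A T₀`. [cite: LawlerSchrammWerner2001, Thm. 2.2] -/
theorem exists_thr_image_brownian_of_hasMartingaleClock (hA : IsStarHull A) {H : (ℝ≥0 → ℝ) → WithTop ℝ≥0}
    {T : ℝ≥0} {C : ℝ} (hHst : IsStoppingTime brownianFiltration H)
    (hHT : ∀ ω, H ω ≤ (T : WithTop ℝ≥0))
    (hclock : HasMartingaleClock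
      (fun t ω ↦ (Real.sqrt 6)⁻¹ * stoppedProcess
        (fun t ω ↦ thrImageDriver (drvK 6 (brownianCPath ω)) A t) H t ω)
      (fun t ω ↦ thrClock (drvK 6 (brownianCPath ω)) A (min (t : ℝ) (((H ω).untopD 0 : ℝ≥0) : ℝ)))
      brownianFiltration preWienerMeasure C)
    (hYad : StronglyAdapted brownianFiltration (fun t ω ↦ (Real.sqrt 6)⁻¹ * stoppedProcess
        (fun t ω ↦ thrImageDriver (drvK 6 (brownianCPath ω)) A t) H t ω))
    (hYc : ∀ ω, Continuous fun t ↦ (Real.sqrt 6)⁻¹ * stoppedProcess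
        (fun t ω ↦ thrImageDriver (drvK 6 (brownianCPath ω)) A t) H t ω)
    (hcad : Adapted brownianFiltration
      (fun t ω ↦ thrClock (drvK 6 (brownianCPath ω)) A (min (t : ℝ) (((H ω).untopD 0 : ℝ≥0) : ℝ))))
    (hint : ∀ ω, IntegrableOn (thrClockRate (drvK 6 (brownianCPath ω)) A)
      (Icc (0 : ℝ) (((H ω).untopD 0 : ℝ≥0) : ℝ))) :
    ∃ Bc : ℝ≥0 → (ℝ≥0 → ℝ) × (ℝ≥0 → ℝ) → ℝ,
      IsBrownianReal Bc (preWienerMeasure.prod preWienerMeasure) ∧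
      (∀ s, Measurable (Bc s)) ∧ (∀ z, Continuous (Bc · z)) ∧
      ∀ (z : (ℝ≥0 → ℝ) × (ℝ≥0 → ℝ)) (T₀ : ℝ≥0), H z.1 = T₀ → 0 < T₀ →
        ∀ s : ℝ≥0, (s : ℝ) ≤ thrClock (drvK 6 (brownianCPath z.1)) A T₀ →
          Real.sqrt 6 * Bc s z = thrImageDriverC (drvK 6 (brownianCPath z.1)) A T₀ s := by
  haveI := isProbabilityMeasure_preWienerMeasure'
  have h6 : (0 : ℝ) < Real.sqrt 6 := Real.sqrt_pos.2 (by norm_num)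
  set P : Measure (ℝ≥0 → ℝ) := preWienerMeasure with hPdef
  set ρ : (ℝ≥0 → ℝ) → ℝ≥0 := fun ω ↦ (H ω).untopD 0 with hρdef
  have hHtop : ∀ ω, H ω ≠ ⊤ := fun ω ↦ ne_top_of_le_ne_top WithTop.coe_ne_top (hHT ω)
  have hρcoe : ∀ ω, (ρ ω : WithTop ℝ≥0) = H ω := fun ω ↦ by
    obtain ⟨a, ha⟩ := WithTop.ne_top_iff_exists.1 (hHtop ω)
    rw [hρdef]; simp only; rw [← ha, WithTop.untopD_coe]
  set Y : ℝ≥0 → (ℝ≥0 → ℝ) → ℝ := fun t ω ↦ (Real.sqrt 6)⁻¹ * stoppedProcess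
    (fun t ω ↦ thrImageDriver (drvK 6 (brownianCPath ω)) A t) H t ω with hYdef
  set c : ℝ≥0 → (ℝ≥0 → ℝ) → ℝ := fun t ω ↦
    thrClock (drvK 6 (brownianCPath ω)) A (min (t : ℝ) (((H ω).untopD 0 : ℝ≥0) : ℝ)) with hcdef
  set 𝓕 : Filtration ℝ≥0 (inferInstance : MeasurableSpace (ℝ≥0 → ℝ)) := brownianFiltration with h𝓕
  have hcρ : ∀ t ω, c t ω = thrClock (drvK 6 (brownianCPath ω)) A (min (t : ℝ) (ρ ω)) := fun t ω ↦ rfl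
  -- Step 1: the time change
  have hρst : IsStoppingTime 𝓕 fun ω ↦ (ρ ω : WithTop ℝ≥0) := by
    have heq : (fun ω ↦ (ρ ω : WithTop ℝ≥0)) = H := funext hρcoe
    rw [heq]; exact hHst
  have hρT : ∀ ω, ρ ω ≤ T := fun ω ↦ by
    have := hHT ω; rw [← hρcoe] at this; exact WithTop.coe_le_coe.1 this
  have hfrozen : ∀ t ω, c t ω = c (min t (ρ ω)) ω := by
    intro t ω
    rw [hcρ, hcρ, NNReal.coe_min, min_assoc, min_self]
  have htc := hclock.timeChange hYad hYc hcad hρst hρT hfrozen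
  have hcc := hclock.continuous_clock
  have hc0 := hclock.clock_zero
  have hmono := hclock.monotone_clock
  have hnn : ∀ t ω, 0 ≤ c t ω := fun t ω ↦ hclock.clock_nonneg ω t
  have hstrict : ∀ ω, StrictMonoOn (fun t ↦ c t ω) (Icc 0 (ρ ω)) := by
    intro ω s hs t ht hst
    show c s ω < c t ω
    rw [hcρ, hcρ, min_eq_left (NNReal.coe_le_coe.2 hs.2), min_eq_left (NNReal.coe_le_coe.2 ht.2)]
    exact strictMonoOn_thrClock (hint ω) ⟨s.coe_nonneg, NNReal.coe_le_coe.2 hs.2⟩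
      ⟨t.coe_nonneg, NNReal.coe_le_coe.2 ht.2⟩ (NNReal.coe_lt_coe.2 hst)
  set 𝒢 := tcFiltration hcad hcc hρst with h𝒢def
  -- Step 2: concatenation with an independent Brownian motion
  set σc : (ℝ≥0 → ℝ) → ℝ≥0 := fun ω ↦ (totalClock c ρ ω).toNNReal with hσcdef
  have hσc0 : ∀ ω, 0 ≤ totalClock c ρ ω := fun ω ↦ hclock.clock_nonneg ω _
  have hσccoe : ∀ ω, ((σc ω : ℝ≥0) : ℝ) = totalClock c ρ ω := fun ω ↦ Real.coe_toNNReal _ (hσc0 ω)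
  have hmin_eq : ∀ (s : ℝ≥0) ω, min (s : ℝ) (totalClock c ρ ω) = ((min s (σc ω) : ℝ≥0) : ℝ) := by
    intro s ω; rw [NNReal.coe_min, hσccoe]
  have htc' : HasMartingaleClock (tcProc Y c ρ) (fun s ω ↦ ((min s (σc ω) : ℝ≥0) : ℝ)) 𝒢 P C := by
    have heq : (fun (s : ℝ≥0) ω ↦ ((min s (σc ω) : ℝ≥0) : ℝ)) =
        fun (s : ℝ≥0) ω ↦ min (s : ℝ) (totalClock c ρ ω) := by
      funext s ω; exact (hmin_eq s ω).symm
    rw [heq]; exact htc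
  have hYprog : IsStronglyProgressive 𝓕 Y := hYad.isStronglyProgressive_of_continuous hYc
  have hcontY : ∀ ω, Continuous fun s ↦ tcProc Y c ρ s ω := continuous_tcProc hYc hc0 hcc hmono hstrict
  have hYad' : ∀ s, StronglyMeasurable[𝒢 s] (tcProc Y c ρ s) := fun s ↦
    (measurable_tcProc hcad hcc hρst hYprog s).stronglyMeasurable
  have hσcm : Measurable σc := (measurable_totalClock hcad hcc hρst).real_toNNReal
  have hcad' : ∀ s : ℝ≥0, Measurable[𝒢 s] fun ω ↦ min s (σc ω) := by
    intro s
    have h1 := (measurable_min_totalClock hcad hcc hρst hc0 hmono hfrozen s).real_toNNReal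
    have heq : (fun ω ↦ (min (s : ℝ) (totalClock c ρ ω)).toNNReal) = fun ω ↦ min s (σc ω) := by
      funext ω; rw [hmin_eq, Real.toNNReal_coe]
    rwa [heq] at h1
  have hY0 : ∀ ω, tcProc Y c ρ 0 ω = 0 := fun ω ↦ by
    rw [tcProc_zero hc0]
    show (Real.sqrt 6)⁻¹ * stoppedProcess (fun t ω ↦ thrImageDriver (drvK 6 (brownianCPath ω)) A t) H 0 ω = 0
    have hWc : Continuous (drvK 6 (brownianCPath ω)) := continuous_drvK 6 _
    have hW0 : drvK 6 (brownianCPath ω) 0 = 0 := by rw [drvK_brownianCPath]; exact sleDriving_zero 6 ω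
    rw [stoppedProcess_eq_of_le (by simp), thrImageDriver, thrSlidHull, remHull_zero hWc hW0 hA,
      slidHull_zero_of_zero hWc hW0 hA, hW0, zero_add, sub_self, mul_zero]
  set M : ℝ≥0 → (ℝ≥0 → ℝ) × (ℝ≥0 → ℝ) → ℝ := fun s z ↦ tcProc Y c ρ s z.1 +
    (Process.brownian s z.2 - Process.brownian (min s (σc z.1)) z.2) with hMdef
  have hBM : IsBrownianReal M (P.prod preWienerMeasure) :=
    isBrownianReal_concat htc' hcontY hYad' hσcm hcad' hY0 rfl
  have hMc : ∀ z, Continuous (M · z) := continuous_concat rfl hcontY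
  have hMm : ∀ t, Measurable (M t) := measurable_concat hMdef hYad' hcad'
  refine ⟨M, hBM, hMm, hMc, ?_⟩
  -- Step 3: agreement with the through-swallow image driver in capacity time
  rintro ⟨ω, ω'⟩ T₀ hT₀ hT0 s hs
  simp only at hT₀ hs ⊢
  set W := drvK 6 (brownianCPath ω) with hWdef
  have hρω : ρ ω = T₀ := WithTop.coe_injective ((hρcoe ω).trans hT₀)
  have hintω : IntegrableOn (thrClockRate W A) (Icc (0 : ℝ) T₀) := by rw [← hρω]; exact hint ω
  -- the capacity time `s` is `σ(t)` for `t = τ_clock(s) ∈ [0, T₀]`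
  have hsI : (s : ℝ) ∈ Icc (0 : ℝ) (thrClock W A T₀) := ⟨s.coe_nonneg, hs⟩
  obtain ⟨htI, hσt⟩ := thrClockInv_spec hintω hsI
  set t : ℝ := thrClockInv W A T₀ s with htdef
  set t' : ℝ≥0 := t.toNNReal with ht'def
  have ht'coe : (t' : ℝ) = t := Real.coe_toNNReal _ htI.1
  have ht'le : t' ≤ T₀ := by
    have := Real.toNNReal_le_toNNReal htI.2; rwa [Real.toNNReal_coe] at this
  have ht'ρ : t' ≤ ρ ω := hρω ▸ ht'le
  have ht'H : ((t' : ℝ≥0) : WithTop ℝ≥0) ≤ H ω := by rw [← hρcoe]; exact WithTop.coe_le_coe.2 ht'ρ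
  -- the clock and the process at `t'`
  have hct' : c t' ω = s := by
    rw [hcρ, min_eq_left (NNReal.coe_le_coe.2 ht'ρ), ← hWdef, ht'coe, hσt]
  have hYt' : Y t' ω = (Real.sqrt 6)⁻¹ * thrImageDriver W A t' := by
    show (Real.sqrt 6)⁻¹ * stoppedProcess (fun t ω ↦ thrImageDriver (drvK 6 (brownianCPath ω)) A t) H t' ω =
      (Real.sqrt 6)⁻¹ * thrImageDriver W A t'
    rw [stoppedProcess_eq_of_le ht'H]
  -- `M s = Ỹ_s = Y_{t'}`
  have hle : s ≤ σc ω := by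
    rw [← NNReal.coe_le_coe, hσccoe, totalClock, ← hct']
    exact hmono ω ht'ρ
  have hMs : M s (ω, ω') = Y t' ω := by
    have hcat : M s (ω, ω') = tcProc Y c ρ s ω :=
      @concat_eq_of_le _ (tcProc Y c ρ) σc M hMdef s (ω, ω') hle
    rw [hcat]
    have h1 := tcProc_clock (Y := Y) hcc hstrict hnn ht'ρ
    change tcProc Y c ρ (c t' ω).toNNReal ω = Y t' ω at h1
    rw [hct', Real.toNNReal_coe] at h1
    exact h1
  rw [hMs, hYt', ← mul_assoc, mul_inv_cancel₀ h6.ne', one_mul, thrImageDriverC, min_eq_left hs]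

end Literature.Probability.RandomPlanarGeometry

end
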